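import Literature.Geometry.Kaehler.ComplexTorusPicardHodgeNumbers
import Literature.Geometry.Kaehler.ComplexTorusLineBundleDolbeaultPullback
import Literature.Geometry.Kaehler.ComplexTorusDualPolarizationIndex
import HarnessLib

/-!
# `h^q` under isogenies: `h^q(L′) ≤ h^q(f^*L′)` for every `L′`; `h^q(f^*L′) = deg f · h^q(L′)` for non-degenerate `L′`;
# `h^q(n_X^*L) = n^{2g} · h^q(L)` (Lange 2023, Thm. 1.6.8 + Cor. 1.7.6 + Prop. 1.1.14; Kollár–Mori 1998, Prop. 5.7)

Layer `Literature/Geometry/Kaehler`, namespace `Literature.Geometry.Kaehler.ComplexTorus`; lane `lit-hodgefound`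
(Layer A2, seat `lit-hodgefound-skel-2`, generation 30), row **A2-105** of `run/shared/lean/pub/lit-hodgefound/SKELETON.md`.
THEOREMS ONLY (no definition, no named fact).

For a homomorphism `f = mapMatrix Φ Φ′ A : X = E/Φ(ℤ^ι) → X′ = E′/Φ′(ℤ^ι)` (lattices indexed by the same type) with
complex-linear analytic representation `F` (`Φ′ ∘ A = F ∘ Φ`; `f` is an isogeny iff `F` is bijective, and then
`deg f = #Ker f = |det A|`, Prop. 1.1.13) and `L′ ∈ Pic(X′)` with Appell–Humbert datum `p′ = (H′, χ′)`,
`f^*L′ = L(F^*H′, χ′ ∘ A)` (Lemma 1.3.6; `AHData.pullback`, `Pic.pullback`, row A2-42), this file records the behaviour of the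
numbers `h^q` (rows A2-102 `AHData.hodgeNumber`, A2-103 `Pic.hodgeNumber`) under `f^*`:

* §1 **`h^q(L′) ≤ h^q(f^*L′)` for EVERY `L′` and every `q` when `f` is an isogeny** (`AHData.hodgeNumber_le_hodgeNumber_pullback`,
  `Pic.hodgeNumber_le_hodgeNumber_pullback`) — row A2-104's injectivity of `f^* : H^{0,q}_∂̄(X′, L′) → H^{0,q}_∂̄(X, f^*L′)`
  (the trace over `Ker f` splits it: Kollár–Mori Prop. 5.7), read through `hodgeNumber_eq_finrank`; equality fails in
  general (`f^*𝒪_{X′} = 𝒪_X`: `AHData.hodgeNumber_pullback_one`).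
* §2 **`h^q(f^*L′) = deg f · h^q(L′)` for NON-DEGENERATE `L′`, every `q`, `F` bijective** (`AHData.hodgeNumber_pullback_of_nondegenerate`,
  `Pic.hodgeNumber_pullback_of_nondegenerate`): by Mumford's index theorem (Thm. 1.6.8, row A2-102
  `hodgeNumber_eq_ite_of_nondegenerate`) both sides vanish for `q ≠ s`, the indices agree (`s(F^*H′) = s(H′)`, Sylvester:
  tree `hermIndex_pullbackForm_of_bijective`), and at `q = s` the values `d₁⋯d_g(f^*L′) = deg f · d′₁⋯d′_g(L′)` agree by
  Riemann–Roch `χ = (-1)^s d₁⋯d_g` (Thm. 1.7.1) and `χ(f^*L′) = deg f · χ(L′)` (Cor. 1.7.6, row A2-102 `AHData.eulerChar_pullback`):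
  `nondegenerate_pullbackForm_of_bijective`, `AHData.hermIndex_pullback_form`, `AHData.prod_type_pullback_eq_mul`.
* §3 **`h^q(n_X^*L) = n^{2g} · h^q(L)` for non-degenerate `L` and `n ≠ 0`** (`f = n_X`: `A = n·1`, `F = n·id`, `deg n_X = n^{2g}`,
  Prop. 1.1.14; `n_X^*(H, χ) = (n²H, χⁿ)`, Prop. 1.3.7, row A2-43 `AHData.mulN` / `Pic.mulN`): `AHData.hodgeNumber_mulN_of_nondegenerate`,
  `Pic.hodgeNumber_mulN_of_nondegenerate`, `Pic.hodgeNumber_mulN_neg_one`.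

## References

* [Lange2023AbelianVarietiesComplex] H. Lange, *Abelian Varieties over the Complex Numbers* (2023), §1.1.2 Prop. 1.1.13,
  Prop. 1.1.14 (p0022), §1.3.3 Lemma 1.3.6, Prop. 1.3.7, §1.6.3 Thm. 1.6.8, §1.7.1 Thm. 1.7.1, §1.7.2 Cor. 1.7.6.
* [KollarMori1998] J. Kollár, S. Mori, *Birational Geometry of Algebraic Varieties* (1998), Prop. 5.7 (proof).
* [HuybrechtsCG2005] D. Huybrechts, *Complex Geometry* (2005), §2.6 Prop. 2.6.10, Def. 2.6.24.
* [GohbergLancasterRodman2005] I. Gohberg, P. Lancaster, L. Rodman, *Indefinite Linear Algebra and Applications* (2005), Thm. 2.3.2.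
-/

noncomputable section

open Finset Module Complex

namespace Literature.Geometry.Kaehler

namespace ComplexTorus

/-! ## §1 `h^q(L′) ≤ h^q(f^*L′)` for every `L′ ∈ Pic(X′)` and an isogeny `f` -/

section Injective

variable {ι : Type*} [Fintype ι] [DecidableEq ι]
  {E E' : Type*} [NormedAddCommGroup E] [NormedSpace ℂ E] [NormedAddCommGroup E'] [NormedSpace ℂ E']
  [FiniteDimensional ℂ E] [FiniteDimensional ℂ E']
  (Φ : (ι → ℝ) ≃L[ℝ] E) (Φ' : (ι → ℝ) ≃L[ℝ] E') {A : Matrix ι ι ℤ} (F : E ≃L[ℂ] E')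

/-- **`h^q(L′) ≤ h^q(f^*L′)` for an isogeny `f` and every `L′ = L(H′, χ′)`** (`f^*` is injective on `H^{0,q}_∂̄`, row A2-104;
`f^*(H′, χ′) = (F^*H′, χ′ ∘ A)`). [cite: KollarMori1998, Prop. 5.7 (proof)] [cite: HuybrechtsCG2005, §2.6 Prop. 2.6.10 (p0126)] [cite: Lange2023AbelianVarietiesComplex, §1.3.3 Lemma 1.3.6] -/
theorem AHData.hodgeNumber_le_hodgeNumber_pullback
    (hF : ∀ x, Φ' ((A.map (Int.cast : ℤ → ℝ)).mulVec x) = (F : E →L[ℂ] E') (Φ x)) (p' : AHData Φ') (q : ℕ) :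
    p'.hodgeNumber q ≤ (AHData.pullback Φ Φ' hF p').hodgeNumber q := by
  rw [p'.hodgeNumber_eq_finrank (Module.finBasisOfFinrankEq ℂ E' (finrank_eq_finrank Φ Φ').symm) q,
    (AHData.pullback Φ Φ' hF p').hodgeNumber_eq_finrank (Module.finBasis ℂ E) q, AHData.pullback_form]
  exact finrank_dbarCohomology_le_of_equiv Φ Φ' F p'.form p'.char p'.isNSForm_form p'.isSemicharacter_char hF
    (Module.finBasis ℂ E) _ q

/-- **`h^q(L′) ≤ h^q(f^*L′)` on `Pic`: for an isogeny `f` and every class `L′ ∈ Pic(X′)`, `f^* = Pic.pullback`.**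
[cite: KollarMori1998, Prop. 5.7 (proof)] [cite: Lange2023AbelianVarietiesComplex, §1.3.3 Lemma 1.3.6] -/
theorem Pic.hodgeNumber_le_hodgeNumber_pullback
    (hF : ∀ x, Φ' ((A.map (Int.cast : ℤ → ℝ)).mulVec x) = (F : E →L[ℂ] E') (Φ x)) (x' : Pic Φ') (q : ℕ) :
    x'.hodgeNumber q ≤ (Pic.pullback Φ Φ' hF x').hodgeNumber q := by
  obtain ⟨p', rfl⟩ := AHData.toPic_surjective x'
  rw [AHData.toPic_pullback, Pic.hodgeNumber_toPic, Pic.hodgeNumber_toPic]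
  exact AHData.hodgeNumber_le_hodgeNumber_pullback Φ Φ' F hF p' q

end Injective

section Nondegenerate

variable {ι : Type*} [Fintype ι] [DecidableEq ι]
  {E E' : Type*} [NormedAddCommGroup E] [NormedSpace ℂ E] [NormedAddCommGroup E'] [NormedSpace ℂ E']
  [FiniteDimensional ℂ E] [FiniteDimensional ℂ E']
  (Φ : (ι → ℝ) ≃L[ℝ] E) (Φ' : (ι → ℝ) ≃L[ℝ] E') {A : Matrix ι ι ℤ} {F : E →L[ℂ] E'}

/-- **`f^*𝒪_{X′} = 𝒪_X` has `h^q(f^*𝒪_{X′}) = h^q(𝒪_{X′}) = binom(g, q)`** for EVERY homomorphism between tori of the same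
dimension — the inequality of §1 is an equality here without the factor `deg f` (so `h^q(f^*L′) = deg f · h^q(L′)` needs
`L′` non-degenerate, §2). [cite: Lange2023AbelianVarietiesComplex, §1.4.3 Cor. 1.4.11 (b)] [cite: Lange2023AbelianVarietiesComplex, §1.3.3 Lemma 1.3.6] -/
theorem AHData.hodgeNumber_pullback_one (hF : ∀ x, Φ' ((A.map (Int.cast : ℤ → ℝ)).mulVec x) = F (Φ x)) (q : ℕ) :
    (AHData.pullback Φ Φ' hF 1).hodgeNumber q = (1 : AHData Φ').hodgeNumber q := by
  rw [map_one, AHData.hodgeNumber_one, AHData.hodgeNumber_one, finrank_eq_finrank Φ Φ']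

/-! ## §2 `h^q(f^*L′) = deg f · h^q(L′)` for non-degenerate `L′` -/

omit [Fintype ι] [DecidableEq ι] [FiniteDimensional ℂ E] [FiniteDimensional ℂ E'] in
/-- Non-degeneracy is preserved by pull-back along a bijective `ℂ`-linear `F` (`F^*H′(v, ·) = H′(Fv, F·)`).
[cite: Lange2023AbelianVarietiesComplex, §1.6.2 (p0066)] -/
theorem nondegenerate_pullbackForm_of_bijective (hFb : Function.Bijective F) {η' : E' [⋀^Fin 2]→L[ℝ] ℝ}
    (hnd : ∀ v : E', v ≠ 0 → ∃ u : E', η' ![v, u] ≠ 0) (v : E) (hv : v ≠ 0) : ∃ u : E, pullbackForm F η' ![v, u] ≠ 0 := by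
  obtain ⟨u', hu'⟩ := hnd (F v) fun h ↦ hv (hFb.1 (by rw [h, map_zero]))
  obtain ⟨u, rfl⟩ := hFb.2 u'
  exact ⟨u, by rwa [pullbackForm_apply]⟩

omit [DecidableEq ι] [FiniteDimensional ℂ E] [FiniteDimensional ℂ E'] in
/-- **`s(f^*L′) = s(L′)`**: the index of `F^*H′` equals the index of `H′` for a bijective `F` (Sylvester).
[cite: GohbergLancasterRodman2005, §2.3 Thm. 2.3.2] [cite: Lange2023AbelianVarietiesComplex, §1.6.2 (p0066)] -/
theorem AHData.hermIndex_pullback_form (hF : ∀ x, Φ' ((A.map (Int.cast : ℤ → ℝ)).mulVec x) = F (Φ x))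
    (hFb : Function.Bijective F) (p' : AHData Φ') : hermIndex (AHData.pullback Φ Φ' hF p').form = hermIndex p'.form := by
  rw [AHData.pullback_form]
  exact hermIndex_pullbackForm_of_bijective F hFb p'.form

/-- **`d₁⋯d_g(f^*L′) = deg f · d′₁⋯d′_g(L′)` for non-degenerate `L′` and bijective `F`** (types of `F^*H′` on `Λ` and of `H′`
on `Λ′`): from `χ = (-1)^s d₁⋯d_g` (Thm. 1.7.1) on both sides, `s(f^*L′) = s(L′)`, and `χ(f^*L′) = deg f · χ(L′)` (Cor. 1.7.6).
[cite: Lange2023AbelianVarietiesComplex, §1.7.2 Cor. 1.7.6] [cite: Lange2023AbelianVarietiesComplex, §1.7.1 Thm. 1.7.1] -/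
theorem AHData.prod_type_pullback_eq_mul (hF : ∀ x, Φ' ((A.map (Int.cast : ℤ → ℝ)).mulVec x) = F (Φ x))
    (hFb : Function.Bijective F) (p' : AHData Φ') (hnd' : ∀ v : E', v ≠ 0 → ∃ u : E', p'.form ![v, u] ≠ 0)
    {g g' : ℕ} {d : Fin g → ℕ} {d' : Fin g' → ℕ} (hd : IsPolarizationType Φ (AHData.pullback Φ Φ' hF p').form d)
    (hd' : IsPolarizationType Φ' p'.form d') : ∏ i, d i = Nat.card (mapMatrixHom Φ Φ' A).ker * ∏ i, d' i := by
  have hnd : ∀ v : E, v ≠ 0 → ∃ u : E, (AHData.pullback Φ Φ' hF p').form ![v, u] ≠ 0 :=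
    nondegenerate_pullbackForm_of_bijective hFb hnd'
  have h1 := (AHData.pullback Φ Φ' hF p').eulerChar_eq_of_nondegenerate hnd hd
  have h2 := p'.eulerChar_eq_of_nondegenerate hnd' hd'
  have h3 := AHData.eulerChar_pullback Φ Φ' hF p'
  rw [h1, h2, AHData.hermIndex_pullback_form Φ Φ' hF hFb p', mul_left_comm] at h3
  have h4 := mul_left_cancel₀ (pow_ne_zero _ (by norm_num : (-1 : ℤ) ≠ 0)) h3
  exact_mod_cast h4

/-- **`h^q(f^*L′) = deg f · h^q(L′)` for NON-DEGENERATE `L′ = L(H′, χ′)`, every `q`, `F` bijective** (`deg f = #Ker f`):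
Mumford's index theorem `h^q = d₁⋯d_g` for `q = s` and `0` otherwise (Thm. 1.6.8) on both sides, `s(f^*L′) = s(L′)`, and
`d₁⋯d_g(f^*L′) = deg f · d′₁⋯d′_g(L′)` (Cor. 1.7.6 with Thm. 1.7.1).
[cite: Lange2023AbelianVarietiesComplex, §1.6.3 Thm. 1.6.8] [cite: Lange2023AbelianVarietiesComplex, §1.7.2 Cor. 1.7.6] [cite: Lange2023AbelianVarietiesComplex, §1.1.2 Prop. 1.1.13] -/
theorem AHData.hodgeNumber_pullback_of_nondegenerate (hF : ∀ x, Φ' ((A.map (Int.cast : ℤ → ℝ)).mulVec x) = F (Φ x))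
    (hFb : Function.Bijective F) (p' : AHData Φ') (hnd' : ∀ v : E', v ≠ 0 → ∃ u : E', p'.form ![v, u] ≠ 0) (q : ℕ) :
    (AHData.pullback Φ Φ' hF p').hodgeNumber q = Nat.card (mapMatrixHom Φ Φ' A).ker * p'.hodgeNumber q := by
  have hnd : ∀ v : E, v ≠ 0 → ∃ u : E, (AHData.pullback Φ Φ' hF p').form ![v, u] ≠ 0 :=
    nondegenerate_pullbackForm_of_bijective hFb hnd'
  obtain ⟨g', d', hd', -⟩ := p'.isNSForm_form.exists_isPolarizationType_of_nondegenerate Φ' hnd'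
  obtain ⟨g, d, hd, -⟩ := (AHData.pullback Φ Φ' hF p').isNSForm_form.exists_isPolarizationType_of_nondegenerate Φ hnd
  rw [(AHData.pullback Φ Φ' hF p').hodgeNumber_eq_ite_of_nondegenerate hnd hd q,
    p'.hodgeNumber_eq_ite_of_nondegenerate hnd' hd' q, AHData.hermIndex_pullback_form Φ Φ' hF hFb p']
  split_ifs
  · exact AHData.prod_type_pullback_eq_mul Φ Φ' hF hFb p' hnd' hd hd'
  · rw [mul_zero]

/-- **`h^s(f^*L′) = deg f · d′₁⋯d′_g` at the index `s = s(L′)`** for non-degenerate `L′` of type `(d′₁, …, d′_g)`, `F` bijective.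
[cite: Lange2023AbelianVarietiesComplex, §1.6.3 Thm. 1.6.8] [cite: Lange2023AbelianVarietiesComplex, §1.7.2 Cor. 1.7.6] -/
theorem AHData.hodgeNumber_pullback_hermIndex_of_nondegenerate
    (hF : ∀ x, Φ' ((A.map (Int.cast : ℤ → ℝ)).mulVec x) = F (Φ x)) (hFb : Function.Bijective F) (p' : AHData Φ')
    (hnd' : ∀ v : E', v ≠ 0 → ∃ u : E', p'.form ![v, u] ≠ 0) {g' : ℕ} {d' : Fin g' → ℕ}
    (hd' : IsPolarizationType Φ' p'.form d') :
    (AHData.pullback Φ Φ' hF p').hodgeNumber (hermIndex p'.form) = Nat.card (mapMatrixHom Φ Φ' A).ker * ∏ i, d' i := by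
  rw [AHData.hodgeNumber_pullback_of_nondegenerate Φ Φ' hF hFb p' hnd', p'.hodgeNumber_eq_ite_of_nondegenerate hnd' hd',
    if_pos rfl]

/-- **`h⁰(f^*L′) = deg f · h⁰(L′)` for POSITIVE `L′` and bijective `F`** (`s = 0`: theta functions, `h⁰(L′) = d′₁⋯d′_g`).
[cite: Lange2023AbelianVarietiesComplex, §1.6.3 Thm. 1.6.8] [cite: Lange2023AbelianVarietiesComplex, §1.7.2 Cor. 1.7.6] -/
theorem AHData.hodgeNumber_zero_pullback_of_isRiemannForm
    (hF : ∀ x, Φ' ((A.map (Int.cast : ℤ → ℝ)).mulVec x) = F (Φ x)) (hFb : Function.Bijective F) (p' : AHData Φ')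
    (hpos : IsRiemannForm Φ' p'.form) :
    (AHData.pullback Φ Φ' hF p').hodgeNumber 0 = Nat.card (mapMatrixHom Φ Φ' A).ker * p'.hodgeNumber 0 :=
  AHData.hodgeNumber_pullback_of_nondegenerate Φ Φ' hF hFb p' (nondegenerate_of_isRiemannForm hpos) 0

/-- **`h^q(f^*L′) = deg f · h^q(L′)` on `Pic` for non-degenerate classes** (`Pic.nsForm L′` non-degenerate), `F` bijective.
[cite: Lange2023AbelianVarietiesComplex, §1.6.3 Thm. 1.6.8] [cite: Lange2023AbelianVarietiesComplex, §1.7.2 Cor. 1.7.6] [cite: Lange2023AbelianVarietiesComplex, §1.3.2 Thm. 1.3.3] -/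
theorem Pic.hodgeNumber_pullback_of_nondegenerate (hF : ∀ x, Φ' ((A.map (Int.cast : ℤ → ℝ)).mulVec x) = F (Φ x))
    (hFb : Function.Bijective F) (x' : Pic Φ') (hnd' : ∀ v : E', v ≠ 0 → ∃ u : E', Pic.nsForm x' ![v, u] ≠ 0) (q : ℕ) :
    (Pic.pullback Φ Φ' hF x').hodgeNumber q = Nat.card (mapMatrixHom Φ Φ' A).ker * x'.hodgeNumber q := by
  obtain ⟨p', rfl⟩ := AHData.toPic_surjective x'
  have hform := AHData.form_ahEquivPic_symm (AHData.toPic p')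
  rw [AHData.ahEquivPic_symm_toPic] at hform
  rw [← hform] at hnd'
  rw [AHData.toPic_pullback, Pic.hodgeNumber_toPic, Pic.hodgeNumber_toPic]
  exact AHData.hodgeNumber_pullback_of_nondegenerate Φ Φ' hF hFb p' hnd' q

end Nondegenerate

/-! ## §3 `h^q(n_X^*L) = n^{2g} · h^q(L)` for non-degenerate `L` and `n ≠ 0` -/

section MulN

variable {ι : Type*} [Fintype ι] [DecidableEq ι] {E : Type*} [NormedAddCommGroup E] [NormedSpace ℂ E]
  [FiniteDimensional ℂ E] (Φ : (ι → ℝ) ≃L[ℝ] E)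

omit [Fintype ι] [DecidableEq ι] [FiniteDimensional ℂ E] in
/-- `n · id_V` is bijective for `n ≠ 0` (the analytic representation of `n_X`). [cite: Lange2023AbelianVarietiesComplex, §1.1.2 Prop. 1.1.14] -/
theorem bijective_intCast_smul_id {n : ℤ} (hn : n ≠ 0) :
    Function.Bijective ((n : ℂ) • ContinuousLinearMap.id ℂ E) := by
  have hn' : (n : ℂ) ≠ 0 := Int.cast_ne_zero.2 hn
  refine ⟨fun v w h ↦ smul_right_injective E hn' (by simpa using h), fun w ↦ ⟨(n : ℂ)⁻¹ • w, ?_⟩⟩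
  simp [smul_smul, inv_mul_cancel₀ hn']

/-- **`deg n_X = #X_n = n^{2g}`** as `Nat.card (Ker n_X) = |n|^{2 dim V}` (Prop. 1.1.14, tree `natCard_ker_mapMatrixHom`).
[cite: Lange2023AbelianVarietiesComplex, §1.1.2 Prop. 1.1.14 (p0022)] -/
theorem natCard_ker_mulN_eq_pow (n : ℤ) :
    Nat.card (mapMatrixHom Φ Φ (n • (1 : Matrix ι ι ℤ))).ker = n.natAbs ^ (2 * Module.finrank ℂ E) := by
  rw [natCard_ker_mapMatrixHom, Matrix.det_smul, Matrix.det_one, mul_one, Int.natAbs_pow, card_eq_two_mul_finrank Φ]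

/-- **`h^q(n_X^*L) = n^{2g} · h^q(L)` for non-degenerate `L = L(H, χ)`, `n ≠ 0`, every `q`** (`n_X^*(H, χ) = (n²H, χⁿ)`, row A2-43's
`AHData.mulN`; `deg n_X = n^{2g}`). [cite: Lange2023AbelianVarietiesComplex, §1.6.3 Thm. 1.6.8] [cite: Lange2023AbelianVarietiesComplex, §1.7.2 Cor. 1.7.6] [cite: Lange2023AbelianVarietiesComplex, §1.1.2 Prop. 1.1.14] -/
theorem AHData.hodgeNumber_mulN_of_nondegenerate {n : ℤ} (hn : n ≠ 0) (p : AHData Φ)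
    (hnd : ∀ v : E, v ≠ 0 → ∃ u : E, p.form ![v, u] ≠ 0) (q : ℕ) :
    (AHData.mulN Φ n p).hodgeNumber q = n.natAbs ^ (2 * Module.finrank ℂ E) * p.hodgeNumber q := by
  rw [AHData.mulN_def, AHData.hodgeNumber_pullback_of_nondegenerate Φ Φ _ (bijective_intCast_smul_id hn) p hnd q,
    natCard_ker_mulN_eq_pow]

/-- **`h^q(n_X^*L) = n^{2g} · h^q(L)` on `Pic(X)` for non-degenerate classes**, `n ≠ 0` (row A2-43 `Pic.mulN`).
[cite: Lange2023AbelianVarietiesComplex, §1.6.3 Thm. 1.6.8] [cite: Lange2023AbelianVarietiesComplex, §1.7.2 Cor. 1.7.6] [cite: Lange2023AbelianVarietiesComplex, §1.3.3 Prop. 1.3.7] -/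
theorem Pic.hodgeNumber_mulN_of_nondegenerate {n : ℤ} (hn : n ≠ 0) (x : Pic Φ)
    (hnd : ∀ v : E, v ≠ 0 → ∃ u : E, Pic.nsForm x ![v, u] ≠ 0) (q : ℕ) :
    (Pic.mulN Φ n x).hodgeNumber q = n.natAbs ^ (2 * Module.finrank ℂ E) * x.hodgeNumber q := by
  obtain ⟨p, rfl⟩ := AHData.toPic_surjective x
  have hform := AHData.form_ahEquivPic_symm (AHData.toPic p)
  rw [AHData.ahEquivPic_symm_toPic] at hform
  rw [← hform] at hnd
  rw [AHData.toPic_mulN, Pic.hodgeNumber_toPic, Pic.hodgeNumber_toPic]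
  exact AHData.hodgeNumber_mulN_of_nondegenerate Φ hn p hnd q

/-- **`h^q((-1)_X^*L) = h^q(L)` for non-degenerate classes** (`(-1)_X` is an automorphism, `deg = (-1)^{2g} = 1`).
[cite: Lange2023AbelianVarietiesComplex, §1.7.2 Cor. 1.7.6] [cite: Lange2023AbelianVarietiesComplex, §1.3.3 Prop. 1.3.7] -/
theorem Pic.hodgeNumber_mulN_neg_one_of_nondegenerate (x : Pic Φ) (hnd : ∀ v : E, v ≠ 0 → ∃ u : E, Pic.nsForm x ![v, u] ≠ 0)
    (q : ℕ) : (Pic.mulN Φ (-1) x).hodgeNumber q = x.hodgeNumber q := by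
  rw [Pic.hodgeNumber_mulN_of_nondegenerate Φ (by norm_num) x hnd q, Int.natAbs_neg, Int.natAbs_one, one_pow, one_mul]

end MulN

end ComplexTorus

end Literature.Geometry.Kaehler
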